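import Summits.NavierStokesRegularity.NavierStokesRegularity.Theorems.DirectionEchoDoorDefs
import Summits.NavierStokesRegularity.NavierStokesRegularity.Theorems.DirectionEchoDoorDoors
import HarnessLib

/-!
# `TypeIliouvilleNoTypeII` (stmt-NavierStokesRegularity-0056) — DOOR LINE `si-direction-liouville`
# (S24 «DirectionEchoDoor», K2-dir; filed by nsreg-p1 g21 on DIRECTOR-NS #76 (3), 2026-08-27), ONE-STUB registered skeleton

CURRENCY. This is a DOOR line in the N0 door family (helper currency `--supports stmt-…-0056 --as helper`): its
composition concludes the door T2-dir `TargetDirEchoAllRatios` («no total direction echo under local Type I») BY NAME —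
it does NOT conclude `NoTypeII` (a door never decides the crux; register with
`--crux-decl Summit.NavierStokesRegularity.NavierStokesRegularity.Theorems.DirectionEchoDoorDefs.TargetDirEchoAllRatios`).
K1-dir and the door logic are tree theorems (`Theorems/DirectionEchoDoorDoors.lean`:
`localPointZoomDirEcho_holds`, `closesDirEcho`, `targetDirEchoAllRatios_of_residue`), so the door is conditional on
exactly ONE open typed statement, registered here as the single stub.

THE STUB (K2-dir) `SIDirectionLiouville` (text: `Theorems/DirectionEchoDoorDefs.lean` :92): a door-class profile on
`(−∞,0) × ℝ³` (Type-I TIME rate `|v| ≤ C/√(−t)`, continuous on the open slab, unit-viscosity Oseen–Duhamel between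
negative times, divergence free) whose vorticity DIRECTION field is invariant under EVERY parabolic dilation
(`HasScaleInvariantVorticityDirection v := ∀ κ ∈ (0,1), HasParallelVorticityEcho κ v`, i.e.
`ω(z,s) × ω(√κ z, κ s) = 0` for all `s < 0`, `z`) is not backward-singular at the apex.

SIZE WORD: **XL** (frontier statement; per DIRECTOR-NS #76 (3) ⇒ a statement of record in LADDER-NS, NO pool seat).
Why XL and not L: (i) the closed sub-strata are exactly the ones with an existing Liouville theorem — constant direction
(⇒ `v` independent of the axis coordinate up to a drift ⇒ KNSS 2009 2D Liouville), `ξ = ±e_θ` (axisymmetric no swirl,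
KNSS 2009 Thm 5.2/5.3), self-similar (Tsai 1998 / NRŠ 1996) — and each took a paper; (ii) the generic case «direction
pattern `Ξ(x/√−t)` frozen, magnitude `|ω|` free (e.g. log-periodically pulsating)» has NO mechanism in print: in
similarity variables `W = r·Ξ(y)` the `Ξ^⊥`-component of the vorticity equation gives, at every time,
`2 (∇log r · ∇)Ξ = ((U + y/2)·∇)Ξ − ((Ξ·∇)U)^⊥ − (ΔΞ)^⊥` on `{r > 0, ∇Ξ ≠ 0}` with `U` tied to `W` non-locally
(Biot–Savart under the available decay) — an overdetermined but non-local system whose rigidity is a research problem,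
not a lemma hunt; (iii) the hypothesis carries only the Type-I TIME rate (no spatial decay), so even the reduction of the
constant-direction stratum to KNSS-2D inside THIS class needs the bounded-ancient-mild bridge
(`TypeIAncientMild`) rather than pointwise decay. A prover ≤ L has no first lemma to aim at; the honest first target
would itself be a new sub-stratum Liouville theorem (e.g. «`Ξ` depends on `y₃` only» or «`∇Ξ` bounded away from 0 on an
open cone»), each M–L AFTER someone supplies the mechanism.

CHEAPEST FALSIFIER (for a disprover, ≤ 2 core-h): look for a Type-I ancient mild solution with frozen direction pattern
and pulsating magnitude among the explicitly known families (Beltrami/Trkalian ancient flows have `ω = λv`, direction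
frozen iff `v`'s direction is — these DECAY exponentially backward? no: they grow; check the Type-I time rate fails;
axisymmetric-with-swirl DSS candidates have non-frozen `ξ`) — expected outcome: no inhabitant known (census row).

Disproof used: none exists for this stub (no `Cruxes/…/Disproof.lean` entry bears on K2-dir). Dead lines avoided: this
line shares nothing with `Sketch`/`gradient_bkm_pivot`/`energy_split`/`eternal_split` (rate dichotomies for NoTypeII);
it is a door line and never claims the crux.
-/

namespace Summit.NavierStokesRegularity.NavierStokesRegularity.Cruxes.TypeIliouvilleNoTypeII.SiDirectionLiouville

open Summit.NavierStokesRegularity.NavierStokesRegularity.Theorems.DirectionEchoDoorDefs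
open Summit.NavierStokesRegularity.NavierStokesRegularity.Theorems.DirectionEchoDoorDoors

/-- STUB (K2-dir, size **XL**, frontier statement of record): the scale-invariant-direction Type-I Liouville statement,
verbatim the tree text `DirectionEchoDoorDefs.SIDirectionLiouville`. -/
theorem stub_siDirectionLiouville :
    Summit.NavierStokesRegularity.NavierStokesRegularity.Theorems.DirectionEchoDoorDefs.SIDirectionLiouville := by
  sorry

/-- COMPOSITION (kernel-checked, no sorry of its own): the stub closes the door T2-dir BY NAME through the landed door
logic `targetDirEchoAllRatios_of_residue` (K1-dir `localPointZoomDirEcho_holds` is discharged inside it). -/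
theorem TargetDirEchoAllRatios_of :
    Summit.NavierStokesRegularity.NavierStokesRegularity.Theorems.DirectionEchoDoorDefs.TargetDirEchoAllRatios :=
  targetDirEchoAllRatios_of_residue stub_siDirectionLiouville

/-- the same composition in hypothesis form (for by-name matching of the stub statement). -/
theorem TargetDirEchoAllRatios_of_stub
    (h : Summit.NavierStokesRegularity.NavierStokesRegularity.Theorems.DirectionEchoDoorDefs.SIDirectionLiouville) :
    Summit.NavierStokesRegularity.NavierStokesRegularity.Theorems.DirectionEchoDoorDefs.TargetDirEchoAllRatios :=
  targetDirEchoAllRatios_of_residue h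

end Summit.NavierStokesRegularity.NavierStokesRegularity.Cruxes.TypeIliouvilleNoTypeII.SiDirectionLiouville
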